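import Mathlib
import HarnessLib
import Literature.NumberTheory.DiophantineGeometry.SquarefulSums

/-!
# `N₁(B) ≫ √B`: the Pythagorean lower bound for sums of three squareful numbers

Browning–Van Valckenborgh 2012 (*Sums of three squareful numbers*, Exp. Math. 21, §1) remark that
the term `y = (1, 1, 1)` of their decomposition (1.1) of `N₁(B)` — the triples of coprime *squares*
`x₀² + x₁² = x₂²`, i.e. primitive Pythagorean triples with hypotenuse `≤ √B` — "readily" gives the
lower bound `N₁(B) ≫ B^{1/2}`. This file proves that remark unconditionally, with an explicit
constant:

* `sqrt_div_le_squarefulSumCount` — `√B / 360 ≤ N₁(B)` for every `B ≥ 25`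
  (`squarefulSumCount` of `Literature/NumberTheory/DiophantineGeometry/SquarefulSums.lean`);
* `exists_pos_mul_sqrt_le_squarefulSumCount` — the same as `∃ c > 0, ∀ B ≥ 25, c √B ≤ N₁(B)`.

It complements the named facts `SquarefulSumLowerBound` (Theorem 1 of the paper, with the sharp
conjectural constant `c ≈ 2.6775`, whose series is not proved summable in the tree) and
`SquarefulSumUpperBound` (Theorem 2, `N₁(B) ≪ B^{3/5} log¹² B`).

## Proof

Parametrise primitive Pythagorean triples by `(s, t) = (m + n, n)` with `m` odd and
`gcd(m, n) = 1`: `(a, b, c) = (s² - t², 2st, s² + t²) = (m(m + 2n), 2n(m + n), m² + 2mn + 2n²)`,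
which avoids natural subtraction; `a, b` are coprime (`pyth_coprime`), so `(a², b², c²)` is a
primitive triple of squareful numbers with `a² + b² = c²` (`pyth_mem_squarefulSumTriples`), and
`(m, n) ↦ (a², b², c²)` is injective (`pyth_injective`: `c - a = 2n²`, `a + n² = (m + n)²`).
For `1 ≤ m, n ≤ N` one has `c² ≤ 25 N⁴`. The number of pairs `(m, n) ∈ [1, N]²` with `m` odd and
`gcd(m, n) = 1` is at least `N²/18` (`card_filter_odd_coprime_ge`): there are `⌈N/2⌉ N ≥ N²/2`
pairs with `m` odd; a pair with `g = gcd(m, n) > 1` has `g` odd, so `3 ≤ g ≤ N`, and is one of the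
`⌊N/g⌋²` pairs of multiples of `g`; and `Σ_{g=3}^{N} 1/g² ≤ 4/9` (`sum_Icc_three_inv_sq_le`, from
`1/g² ≤ 1/(g-1) - 1/g`). Hence `N₁(25 N⁴) ≥ N²/18`; for general `B ≥ 25` take
`N = ⌊⌊B/25⌋^{1/4}⌋ ≥ 1` (two `Nat.sqrt`s), for which `25 N⁴ ≤ B < 400 N⁴`, and use monotonicity
of `N₁`.

No new definitions: the parametrisation is written out in each statement.
-/

noncomputable section

open Finset

namespace Literature.NumberTheory.DiophantineGeometry

/-! ### The Pythagorean parametrisation `(m, n) ↦ ((m(m+2n))², (2n(m+n))², (m²+2mn+2n²)²)` -/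

/-- For `m` odd and `gcd(m, n) = 1`, the legs `m(m + 2n)` and `2n(m + n)` of the Pythagorean triple
with parameters `(m + n, n)` are coprime. [folklore] -/
theorem pyth_coprime {m n : ℕ} (hm : Odd m) (hcop : m.Coprime n) :
    (m * (m + 2 * n)).Coprime (2 * n * (m + n)) := by
  have h2 : m.Coprime 2 := Nat.coprime_two_right.2 hm
  have h2' : (m + 2 * n).Coprime 2 := Nat.coprime_two_right.2 (hm.add_even (even_two_mul n))
  have hmn : m.Coprime (m + n) := Nat.coprime_self_add_right.2 hcop
  have h3 : (m + 2 * n).Coprime n := (Nat.coprime_add_mul_right_left m n 2).2 hcop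
  have h4 : (m + 2 * n).Coprime (m + n) := by
    rw [show m + 2 * n = m + n + n by ring]
    exact Nat.coprime_self_add_left.2 (Nat.coprime_add_self_right.2 hcop.symm)
  exact Nat.Coprime.mul_left ((h2.mul_right hcop).mul_right hmn) ((h2'.mul_right h3).mul_right h4)

/-- For `m` odd, `n ≥ 1` and `gcd(m, n) = 1`, the squares of the Pythagorean triple
`(m(m + 2n), 2n(m + n), m² + 2mn + 2n²)` form a primitive triple of squareful numbers
`x + y = z` counted by `N₁(B)` as soon as `z = (m² + 2mn + 2n²)² ≤ B`. [folklore] -/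
theorem pyth_mem_squarefulSumTriples {m n B : ℕ} (hm : Odd m) (hn : 0 < n) (hcop : m.Coprime n)
    (hB : (m ^ 2 + 2 * m * n + 2 * n ^ 2) ^ 2 ≤ B) :
    ((m * (m + 2 * n)) ^ 2, (2 * n * (m + n)) ^ 2, (m ^ 2 + 2 * m * n + 2 * n ^ 2) ^ 2) ∈
      squarefulSumTriples B := by
  rw [mem_squarefulSumTriples_iff]
  have hm0 : 0 < m := hm.pos
  refine ⟨⟨by positivity, by positivity, by ring, (pyth_coprime hm hcop).pow 2 2⟩, hB,
    isPowerful_pow 2 _, isPowerful_pow 2 _, isPowerful_pow 2 _⟩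

/-- The map `(m, n) ↦ ((m(m + 2n))², (2n(m + n))², (m² + 2mn + 2n²)²)` is injective on `ℕ × ℕ`
(`c - a = 2n²` recovers `n`, then `a + n² = (m + n)²` recovers `m`). [folklore] -/
theorem pyth_injective : Function.Injective fun p : ℕ × ℕ =>
    ((p.1 * (p.1 + 2 * p.2)) ^ 2, (2 * p.2 * (p.1 + p.2)) ^ 2,
      (p.1 ^ 2 + 2 * p.1 * p.2 + 2 * p.2 ^ 2) ^ 2) := by
  rintro ⟨m, n⟩ ⟨m', n'⟩ h
  simp only [Prod.mk.injEq] at h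
  obtain ⟨ha, -, hc⟩ := h
  have ha' : m * (m + 2 * n) = m' * (m' + 2 * n') := Nat.pow_left_injective two_ne_zero ha
  have hc' : m ^ 2 + 2 * m * n + 2 * n ^ 2 = m' ^ 2 + 2 * m' * n' + 2 * n' ^ 2 :=
    Nat.pow_left_injective two_ne_zero hc
  have hn2 : n ^ 2 = n' ^ 2 := by nlinarith [ha', hc']
  have hn : n = n' := Nat.pow_left_injective two_ne_zero hn2
  subst hn
  have hs : (m + n) ^ 2 = (m' + n) ^ 2 := by nlinarith [ha']
  have hmn : m + n = m' + n := Nat.pow_left_injective two_ne_zero hs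
  rw [Nat.add_right_cancel hmn]

/-! ### Counting pairs `(m, n)` with `m` odd and `gcd(m, n) = 1` -/

/-- `Σ_{k=3}^{N} 1/k² ≤ 4/9` (indeed `≤ 4/9 - 1/N` for `N ≥ 3`, from `1/k² ≤ 1/(k-1) - 1/k`).
[folklore] -/
theorem sum_Icc_three_inv_sq_le (N : ℕ) :
    ∑ k ∈ Finset.Icc 3 N, (1 : ℝ) / (k : ℝ) ^ 2 ≤ 4 / 9 := by
  rcases lt_or_ge N 3 with hN | hN
  · rw [Finset.Icc_eq_empty_of_lt hN, Finset.sum_empty]; norm_num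
  · suffices h : ∑ k ∈ Finset.Icc 3 N, (1 : ℝ) / (k : ℝ) ^ 2 ≤ 4 / 9 - 1 / N by
      have : (0 : ℝ) ≤ 1 / N := by positivity
      linarith
    induction N, hN using Nat.le_induction with
    | base => norm_num [Finset.Icc_self]
    | succ N hN ih =>
      rw [Finset.sum_Icc_succ_top (by omega)]
      have hN0 : (0 : ℝ) < N := by exact_mod_cast (by omega : 0 < N)
      have key : 1 / ((N : ℝ) + 1) ^ 2 ≤ 1 / N - 1 / (N + 1) := by
        rw [show (1 : ℝ) / N - 1 / (N + 1) = 1 / (N * (N + 1)) by field_simp; ring]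
        apply one_div_le_one_div_of_le (by positivity)
        nlinarith
      push_cast
      linarith

/-- There are at least `N²/18` pairs `(m, n) ∈ [1, N]²` with `m` odd and `gcd(m, n) = 1`: of the
`⌈N/2⌉ N ≥ N²/2` pairs with `m` odd, those with `gcd(m, n) = g > 1` have `g` odd, so `3 ≤ g ≤ N`,
and lie among the `⌊N/g⌋²` pairs of multiples of `g`; and `Σ_{g ≥ 3} 1/g² ≤ 4/9`. [folklore] -/
theorem card_filter_odd_coprime_ge (N : ℕ) :
    (N : ℝ) ^ 2 / 18 ≤
      (((Finset.Icc 1 N ×ˢ Finset.Icc 1 N).filter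
        fun p => Odd p.1 ∧ p.1.Coprime p.2).card : ℝ) := by
  classical
  set D : Finset (ℕ × ℕ) :=
    (Finset.Icc 1 N ×ˢ Finset.Icc 1 N).filter fun p => Odd p.1 ∧ p.1.Coprime p.2 with hD
  set P : Finset (ℕ × ℕ) := (Finset.range ((N + 1) / 2) ×ˢ Finset.Icc 1 N).image
    fun p => (2 * p.1 + 1, p.2) with hP
  set F : ℕ → Finset ℕ := fun k => (Finset.Ioc 0 N).filter (k ∣ ·) with hF
  set M : ℕ → Finset (ℕ × ℕ) := fun k => F k ×ˢ F k with hM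
  have hPcard : P.card = (N + 1) / 2 * N := by
    rw [hP, Finset.card_image_of_injective, Finset.card_product, Finset.card_range, Nat.card_Icc,
      Nat.add_sub_cancel]
    intro p q h
    simp only [Prod.mk.injEq] at h
    exact Prod.ext (by omega) h.2
  have hFcard : ∀ k, (F k).card = N / k := fun k => Nat.Ioc_filter_dvd_card_eq_div N k
  have hcover : P ⊆ D ∪ (Finset.Icc 3 N).biUnion M := by
    intro p hp
    simp only [hP, Finset.mem_image, Finset.mem_product, Finset.mem_range, Finset.mem_Icc] at hp
    obtain ⟨⟨j, n⟩, ⟨hj, hn1, hnN⟩, rfl⟩ := hp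
    have hmN : 2 * j + 1 ≤ N := by omega
    by_cases hc : Nat.Coprime (2 * j + 1) n
    · apply Finset.mem_union_left
      simp only [hD, Finset.mem_filter, Finset.mem_product, Finset.mem_Icc]
      exact ⟨⟨⟨by omega, hmN⟩, hn1, hnN⟩, odd_two_mul_add_one j, hc⟩
    · apply Finset.mem_union_right
      simp only [Finset.mem_biUnion, Finset.mem_Icc]
      have hgodd : Odd (Nat.gcd (2 * j + 1) n) :=
        (odd_two_mul_add_one j).of_dvd_nat (Nat.gcd_dvd_left _ _)
      have hgle : Nat.gcd (2 * j + 1) n ≤ 2 * j + 1 := Nat.gcd_le_left _ (by omega)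
      have hg1 : Nat.gcd (2 * j + 1) n ≠ 1 := hc
      refine ⟨Nat.gcd (2 * j + 1) n, ⟨?_, by omega⟩, ?_⟩
      · obtain ⟨t, ht⟩ := hgodd
        omega
      · simp only [hM, hF, Finset.mem_product, Finset.mem_filter, Finset.mem_Ioc]
        exact ⟨⟨⟨by omega, hmN⟩, Nat.gcd_dvd_left _ _⟩, ⟨⟨by omega, hnN⟩, Nat.gcd_dvd_right _ _⟩⟩
  have hcard : P.card ≤ D.card + ∑ k ∈ Finset.Icc 3 N, N / k * (N / k) := by
    calc P.card ≤ (D ∪ (Finset.Icc 3 N).biUnion M).card := Finset.card_le_card hcover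
      _ ≤ D.card + ((Finset.Icc 3 N).biUnion M).card := Finset.card_union_le _ _
      _ ≤ D.card + ∑ k ∈ Finset.Icc 3 N, (M k).card := by
          gcongr
          exact Finset.card_biUnion_le
      _ = D.card + ∑ k ∈ Finset.Icc 3 N, N / k * (N / k) := by
          simp [hM, Finset.card_product, hFcard]
  have h1 : (N : ℝ) ^ 2 / 2 ≤ (P.card : ℝ) := by
    rw [hPcard]
    push_cast
    have h : N ≤ 2 * ((N + 1) / 2) := by omega
    have h' : (N : ℝ) ≤ 2 * (((N + 1) / 2 : ℕ) : ℝ) := by exact_mod_cast h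
    nlinarith [(Nat.cast_nonneg N : (0 : ℝ) ≤ N)]
  have h2 : (∑ k ∈ Finset.Icc 3 N, ((N / k * (N / k) : ℕ) : ℝ)) ≤ (N : ℝ) ^ 2 * (4 / 9) := by
    calc (∑ k ∈ Finset.Icc 3 N, ((N / k * (N / k) : ℕ) : ℝ))
        ≤ ∑ k ∈ Finset.Icc 3 N, (N : ℝ) ^ 2 * (1 / (k : ℝ) ^ 2) := by
          apply Finset.sum_le_sum
          intro k hk
          simp only [Finset.mem_Icc] at hk
          have hk0 : (0 : ℝ) < k := by exact_mod_cast (show 0 < k by omega)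
          have hdiv : ((N / k : ℕ) : ℝ) ≤ (N : ℝ) / k := Nat.cast_div_le
          push_cast
          calc ((N / k : ℕ) : ℝ) * ((N / k : ℕ) : ℝ) ≤ ((N : ℝ) / k) * ((N : ℝ) / k) :=
                mul_le_mul hdiv hdiv (by positivity) (by positivity)
            _ = (N : ℝ) ^ 2 * (1 / (k : ℝ) ^ 2) := by
                field_simp
      _ = (N : ℝ) ^ 2 * ∑ k ∈ Finset.Icc 3 N, 1 / (k : ℝ) ^ 2 := by rw [Finset.mul_sum]
      _ ≤ (N : ℝ) ^ 2 * (4 / 9) := by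
          gcongr
          exact sum_Icc_three_inv_sq_le N
  have h3 : (P.card : ℝ) ≤ D.card + ∑ k ∈ Finset.Icc 3 N, ((N / k * (N / k) : ℕ) : ℝ) := by
    exact_mod_cast hcard
  linarith

/-! ### Assembly -/

/-- `N₁(25 N⁴) ≥ N²/18`: the squares of the Pythagorean triples with parameters `(m + n, n)`,
`1 ≤ m, n ≤ N`, `m` odd, `gcd(m, n) = 1`, are distinct elements of the set counted by `N₁(25 N⁴)`.
[folklore] -/
theorem sq_div_le_squarefulSumCount_mul_pow_four (N : ℕ) :
    (N : ℝ) ^ 2 / 18 ≤ (squarefulSumCount (25 * N ^ 4) : ℝ) := by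
  classical
  refine (card_filter_odd_coprime_ge N).trans ?_
  set f : ℕ × ℕ → ℕ × ℕ × ℕ := fun p =>
    ((p.1 * (p.1 + 2 * p.2)) ^ 2, (2 * p.2 * (p.1 + p.2)) ^ 2,
      (p.1 ^ 2 + 2 * p.1 * p.2 + 2 * p.2 ^ 2) ^ 2) with hf
  set D : Finset (ℕ × ℕ) :=
    (Finset.Icc 1 N ×ˢ Finset.Icc 1 N).filter fun p => Odd p.1 ∧ p.1.Coprime p.2 with hD
  have hsub : (↑(D.image f) : Set (ℕ × ℕ × ℕ)) ⊆ squarefulSumTriples (25 * N ^ 4) := by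
    intro t ht
    simp only [hD, Finset.coe_image, Set.mem_image, Finset.mem_coe, Finset.mem_filter,
      Finset.mem_product, Finset.mem_Icc] at ht
    obtain ⟨⟨m, n⟩, ⟨⟨⟨hm1, hmN⟩, hn1, hnN⟩, hodd, hcop⟩, rfl⟩ := ht
    apply pyth_mem_squarefulSumTriples hodd (by omega) hcop
    have : m ^ 2 + 2 * m * n + 2 * n ^ 2 ≤ 5 * N ^ 2 := by nlinarith
    calc (m ^ 2 + 2 * m * n + 2 * n ^ 2) ^ 2 ≤ (5 * N ^ 2) ^ 2 := Nat.pow_le_pow_left this 2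
      _ = 25 * N ^ 4 := by ring
  have := Set.ncard_le_ncard hsub (squarefulSumTriples_finite _)
  rw [Set.ncard_coe_finset, Finset.card_image_of_injective _ pyth_injective] at this
  exact_mod_cast this

/-- **`N₁(B) ≫ B^{1/2}`** (Browning–Van Valckenborgh 2012, §1: the term `y = (1, 1, 1)` of (1.1),
i.e. primitive Pythagorean triples, "readily" gives this lower bound), here with the explicit
constant `1/360` for all `B ≥ 25`: `√B / 360 ≤ N₁(B)`. (For `B ≤ 8` one has `N₁(B) = 0`; the
threshold `25 = 3² + 4²` is where the construction starts.) [cite: BrowningValckenborgh2012, §1] -/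
theorem sqrt_div_le_squarefulSumCount {B : ℕ} (hB : 25 ≤ B) :
    Real.sqrt B / 360 ≤ (squarefulSumCount B : ℝ) := by
  set K := B / 25 with hK
  set M := Nat.sqrt K with hM
  set N := Nat.sqrt M with hN
  have hK1 : 1 ≤ K := by omega
  have hM1 : 1 ≤ M := Nat.le_sqrt.2 (by simpa using hK1)
  have hN1 : 1 ≤ N := Nat.le_sqrt.2 (by simpa using hM1)
  have hNM : N * N ≤ M := Nat.sqrt_le M
  have hMK : M * M ≤ K := Nat.sqrt_le K
  have hup : 25 * N ^ 4 ≤ B := by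
    have : N ^ 4 ≤ K :=
      calc N ^ 4 = (N * N) * (N * N) := by ring
        _ ≤ M * M := Nat.mul_le_mul hNM hNM
        _ ≤ K := hMK
    omega
  have hKl : B < 25 * (K + 1) := by omega
  have hMl : K < (M + 1) * (M + 1) := Nat.lt_succ_sqrt K
  have hNl : M < (N + 1) * (N + 1) := Nat.lt_succ_sqrt M
  have hlow : B < 400 * N ^ 4 := by
    have h1 : K + 1 ≤ (M + 1) * (M + 1) := hMl
    have h2 : M + 1 ≤ (N + 1) * (N + 1) := hNl
    have h3 : (M + 1) * (M + 1) ≤ ((N + 1) * (N + 1)) * ((N + 1) * (N + 1)) :=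
      Nat.mul_le_mul h2 h2
    have h4 : N + 1 ≤ 2 * N := by omega
    have h5 : (N + 1) * (N + 1) ≤ (2 * N) * (2 * N) := Nat.mul_le_mul h4 h4
    have h6 : ((N + 1) * (N + 1)) * ((N + 1) * (N + 1)) ≤
        ((2 * N) * (2 * N)) * ((2 * N) * (2 * N)) := Nat.mul_le_mul h5 h5
    calc B < 25 * (K + 1) := hKl
      _ ≤ 25 * (((2 * N) * (2 * N)) * ((2 * N) * (2 * N))) :=
          Nat.mul_le_mul_left _ (h1.trans (h3.trans h6))
      _ = 400 * N ^ 4 := by ring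
  have hsqrt : Real.sqrt B ≤ 20 * (N : ℝ) ^ 2 := by
    rw [show (20 : ℝ) * (N : ℝ) ^ 2 = Real.sqrt ((20 * (N : ℝ) ^ 2) ^ 2) by
      rw [Real.sqrt_sq (by positivity)]]
    apply Real.sqrt_le_sqrt
    have : (B : ℝ) ≤ 400 * (N : ℝ) ^ 4 := by exact_mod_cast hlow.le
    nlinarith
  calc Real.sqrt B / 360 ≤ 20 * (N : ℝ) ^ 2 / 360 := by gcongr
    _ = (N : ℝ) ^ 2 / 18 := by ring
    _ ≤ squarefulSumCount (25 * N ^ 4) := sq_div_le_squarefulSumCount_mul_pow_four N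
    _ ≤ squarefulSumCount B := by exact_mod_cast squarefulSumCount_mono hup

/-- `N₁(B) ≫ √B` in the `∃ c > 0` form: `c √B ≤ N₁(B)` for all `B ≥ 25` with `c = 1/360`.
[cite: BrowningValckenborgh2012, §1] -/
theorem exists_pos_mul_sqrt_le_squarefulSumCount :
    ∃ c : ℝ, 0 < c ∧ ∀ B : ℕ, 25 ≤ B → c * Real.sqrt B ≤ (squarefulSumCount B : ℝ) :=
  ⟨1 / 360, by norm_num, fun B hB => by
    simpa [div_eq_inv_mul, one_div] using sqrt_div_le_squarefulSumCount hB⟩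

end Literature.NumberTheory.DiophantineGeometry
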